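import Summits.CriticalPhenomena.PercolationContinuityZ3.Theorems.PercNearOneGluingNoHeavyLowerTailSahiAbsorbedMember
import Summits.CriticalPhenomena.PercolationContinuityZ3.Theorems.PercNearOneGluingNoHeavyLowerTailSahiSlotPatternPositivity

/-!
# THE SLOT FACE THEOREM at every order and dimension: the pattern functional of an ABSORBED family is `≥ 0`
# termwise — `E_n` is coefficientwise nonnegative in the chain weights, on every `d`-grid, for every family one of
# whose members lies inside all the others (no up-set hypothesis)

Support file (lane `prim-masterthm-p3`, generation 18; `--supports stmt-CriticalPhenomena-4575`).  Pure proofs; the only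
definitions are the bookkeeping ones of ONE signed weight (`mobius`, `faceμ`, `faceF`); no `sorry`, standard axioms.

THE THEOREM (`patternForm_cons_nonneg_of_absorbed`).  Let `g, F_1, …, F_n : [n+1]^d → ℝ` with `0 ≤ g`, `0 ≤ F_j ≤ 1` and
`g · F_j = g` for every `j` (the head is ABSORBED by every tail member; for indicators: `U_0 ⊆ U_j`).  Then
  `patternForm d (n+1) (g, F_1, …, F_n) ≥ 0`,
indeed every term of the symmetrising sum is `≥ 0`: for every relabelling `τ ∈ S_{n+1}^d`,
  `diagForm d (n+1) ((g,F) ∘ τ) = E_{n+1}^{μ_τ}(g', F') ≥ 0`                       (`diagForm_absorbed_eq_sahiE`, `…_nonneg`)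
for an explicit SIGNED weight `μ_τ` on the finite type `Option (Finset (Fin (n+1)))` and an absorbed family `(g', F')` on it whose
joint moments are `E[g' · Π_{j∈B} F'_j] = g(p_0)` and `E[Π_{j∈B} F'_j] = Π_{j∈B} F_j(p_{min B})`, `p_k = τ·diag(k)` — a set function
realised as moments by MÖBIUS INVERSION on the Boolean lattice (`sum_supset_mobius`).  The value theorem of this lane for absorbed
families under an ARBITRARY (signed) weight, `SahiAbsorbed.sahiE_cons_nonneg_of_absorbed` (`E_{n+1}(g',F') = E[g']·R(F')`, `R ≥ 0`
by its nonnegative block recursion as soon as the joint moments are `≤ 1`), then gives the sign.  So the cycle form with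
least-element representatives is, for absorbed families, a sum of products `g(p_0) · Π_blocks (|B|−1)!(1 − Π_{j∈B}F_j(p_{min B}))`
— the "all blocks fail" formula.
COROLLARIES.  `patternForm_setInd_nonneg_of_subset` (events `U_0 ⊆ U_j`, ARBITRARY finsets of `[n+1]^d`), the C-slot SIGN⁺ law
`patternForm_single_nonneg` (`y ∈ ∩_j U_j ⟹ patternForm(1_{{y}}, 1_{U_1}, …) ≥ 0`: the last-slot/first-slot profile is `≥ 0` at
the points of the intersection), hence a new unconditional stratum of `SlotPatternPos d n` / `PatternPosN n d` at every `(d,n)`: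
nested or merely bottom-absorbed families.  With `patternForm_perm_slots` (symmetry, companion file) the absorbed member may sit
in any slot. [this work]
-/

namespace Summit.CriticalPhenomena.PercolationContinuityZ3.Theorems

open Finset Function Equiv Equiv.Perm
open Literature.Combinatorics.Sahi2008 Literature.Combinatorics.Sahi2008.CycleForm
open Literature.Probability.LatticeModels

namespace SahiSlot

section Mobius

open scoped Classical

variable {κ : Type*} [Fintype κ] [DecidableEq κ]

/-- **Möbius transform on the Boolean lattice** (up-set version): `mobius V S = Σ_{T ⊇ S} (−1)^{|T|−|S|} V(T)`. [this work] -/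
noncomputable def mobius (V : Finset κ → ℝ) (S : Finset κ) : ℝ :=
  ∑ T ∈ univ.filter (fun T : Finset κ => S ⊆ T), (-1 : ℝ) ^ (T.card - S.card) * V T

/-- The signed count of an interval of the Boolean lattice: `Σ_{O ⊆ S ⊆ T} (−1)^{|T|−|S|} = [T = O]` (for `O ⊆ T`). [this work] -/
theorem sum_Icc_neg_one_pow {O T : Finset κ} (hOT : O ⊆ T) :
    ∑ S ∈ univ.filter (fun S : Finset κ => O ⊆ S ∧ S ⊆ T), (-1 : ℝ) ^ (T.card - S.card) = if T = O then 1 else 0 := by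
  -- re-index `S = T \ D`, `D ⊆ T \ O`
  have himage : univ.filter (fun S : Finset κ => O ⊆ S ∧ S ⊆ T) = (T \ O).powerset.image (fun D => T \ D) := by
    ext S
    simp only [mem_filter, mem_univ, true_and, mem_image, mem_powerset]
    constructor
    · rintro ⟨hOS, hST⟩
      refine ⟨T \ S, sdiff_subset_sdiff subset_rfl hOS, ?_⟩
      rw [sdiff_sdiff_right_self, inf_eq_inter, inter_eq_right.2 hST]
    · rintro ⟨D, hD, rfl⟩
      refine ⟨fun x hx => ?_, sdiff_subset⟩
      rw [mem_sdiff]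
      exact ⟨hOT hx, fun hxD => (mem_sdiff.1 (hD hxD)).2 hx⟩
  have hinj : Set.InjOn (fun D => T \ D) ↑((T \ O).powerset) := by
    intro D₁ hD₁ D₂ hD₂ h
    rw [coe_powerset] at hD₁ hD₂
    have h1 : D₁ ⊆ T := fun x hx => (mem_sdiff.1 (hD₁ hx)).1
    have h2 : D₂ ⊆ T := fun x hx => (mem_sdiff.1 (hD₂ hx)).1
    have := congrArg (fun S => T \ S) h
    simp only at this
    rwa [sdiff_sdiff_right_self, sdiff_sdiff_right_self, inf_eq_inter, inf_eq_inter, inter_eq_right.2 h1,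
      inter_eq_right.2 h2] at this
  rw [himage, sum_image hinj]
  have hcard : ∀ D ∈ (T \ O).powerset, T.card - (T \ D).card = D.card := by
    intro D hD
    rw [mem_powerset] at hD
    have hDT : D ⊆ T := fun x hx => (mem_sdiff.1 (hD hx)).1
    rw [card_sdiff_of_subset hDT]
    have := card_le_card hDT
    omega
  rw [sum_congr rfl fun D hD => by rw [hcard D hD]]
  by_cases hTO : T = O
  · subst hTO
    rw [if_pos rfl, sdiff_self, Finset.bot_eq_empty, powerset_empty, sum_singleton, card_empty, pow_zero]
  · rw [if_neg hTO]
    have hne : (T \ O).Nonempty := by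
      rw [Finset.sdiff_nonempty]
      exact fun h => hTO (Subset.antisymm h hOT)
    exact_mod_cast Finset.sum_powerset_neg_one_pow_card_of_nonempty hne

/-- **Möbius inversion**: `Σ_{S ⊇ O} mobius V S = V O` — every set function is the "superset-sum" of its Möbius transform.
[this work] -/
theorem sum_supset_mobius (V : Finset κ → ℝ) (O : Finset κ) :
    ∑ S ∈ univ.filter (fun S : Finset κ => O ⊆ S), mobius V S = V O := by
  unfold mobius
  -- write both filters as indicators and swap the sums
  have hswap : ∑ S ∈ univ.filter (fun S : Finset κ => O ⊆ S), ∑ T ∈ univ.filter (fun T : Finset κ => S ⊆ T),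
      (-1 : ℝ) ^ (T.card - S.card) * V T =
      ∑ T : Finset κ, V T * ∑ S ∈ univ.filter (fun S : Finset κ => O ⊆ S ∧ S ⊆ T), (-1 : ℝ) ^ (T.card - S.card) := by
    calc ∑ S ∈ univ.filter (fun S : Finset κ => O ⊆ S), ∑ T ∈ univ.filter (fun T : Finset κ => S ⊆ T),
          (-1 : ℝ) ^ (T.card - S.card) * V T
        = ∑ S : Finset κ, ∑ T : Finset κ, (if O ⊆ S ∧ S ⊆ T then (-1 : ℝ) ^ (T.card - S.card) * V T else 0) := by
          rw [sum_filter]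
          refine sum_congr rfl fun S _ => ?_
          split_ifs with h
          · rw [sum_filter]
            refine sum_congr rfl fun T _ => ?_
            simp [h]
          · symm
            refine sum_eq_zero fun T _ => ?_
            simp [h]
      _ = ∑ T : Finset κ, ∑ S : Finset κ, (if O ⊆ S ∧ S ⊆ T then (-1 : ℝ) ^ (T.card - S.card) * V T else 0) := sum_comm
      _ = ∑ T : Finset κ, V T * ∑ S ∈ univ.filter (fun S : Finset κ => O ⊆ S ∧ S ⊆ T), (-1 : ℝ) ^ (T.card - S.card) := by
          refine sum_congr rfl fun T _ => ?_
          rw [sum_filter, mul_sum]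
          refine sum_congr rfl fun S _ => ?_
          split_ifs <;> ring
  rw [hswap]
  have hterm : ∀ T : Finset κ, V T * ∑ S ∈ univ.filter (fun S : Finset κ => O ⊆ S ∧ S ⊆ T), (-1 : ℝ) ^ (T.card - S.card) =
      if T = O then V O else 0 := by
    intro T
    by_cases hOT : O ⊆ T
    · rw [sum_Icc_neg_one_pow hOT]
      split_ifs with h
      · rw [h, mul_one]
      · rw [mul_zero]
    · have hempty : univ.filter (fun S : Finset κ => O ⊆ S ∧ S ⊆ T) = ∅ := by
        rw [Finset.filter_eq_empty_iff]
        intro S _ h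
        exact hOT (h.1.trans h.2)
      rw [hempty, sum_empty, mul_zero, if_neg]
      rintro rfl
      exact hOT subset_rfl
  simp_rw [hterm]
  rw [Finset.sum_ite_eq' univ O, if_pos (mem_univ _)]

end Mobius

/-! ### The signed weight realising the block products of an absorbed family -/

section Face

open scoped Classical

variable {n : ℕ} {X : Type*} (h : Fin (n + 1) → X → ℝ) (p : Fin (n + 1) → X)

/-- The block set function: `W(O) = Π_{i∈O} h_i(p_{min O})` (and `0` on `∅`). [this work] -/
noncomputable def blockW (O : Finset (Fin (n + 1))) : ℝ :=
  if hO : O.Nonempty then ∏ i ∈ O, h i (p (O.min' hO)) else 0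

/-- **The signed weight** on `Option (Finset (Fin (n+1)))`: mass `h_0(p_0)` at the extra atom, Möbius masses of
`W − h_0(p_0)` on the subsets. [this work] -/
noncomputable def faceμ : Option (Finset (Fin (n + 1))) → ℝ
  | none => h 0 (p 0)
  | some S => mobius (fun O => blockW h p O - h 0 (p 0)) S

/-- **The absorbed family on the atoms**: everything is `1` at the extra atom; on a subset `S` the head vanishes and the tail
members are the coordinate indicators `[i ∈ S]`. [this work] -/
noncomputable def faceF (i : Fin (n + 1)) : Option (Finset (Fin (n + 1))) → ℝ
  | none => 1
  | some S => if i = 0 then 0 else if i ∈ S then 1 else 0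

/-- `E[faceF 0] = h_0(p_0)`. [this work] -/
theorem ex_faceF_zero : ex (faceμ h p) (faceF 0) = h 0 (p 0) := by
  rw [ex_def, Fintype.sum_option]
  simp [faceμ, faceF]

/-- The head is absorbed by every member on the atoms: `faceF 0 · faceF i = faceF 0`. [this work] -/
theorem faceF_zero_mul (i : Fin (n + 1)) (x : Option (Finset (Fin (n + 1)))) : faceF 0 x * faceF i x = faceF 0 x := by
  cases x <;> simp [faceF]

/-- On a subset atom, a block avoiding the head reads the indicator `[O ⊆ S]`. [this work] -/
theorem prod_faceF_some {O : Finset (Fin (n + 1))} (hO : (0 : Fin (n + 1)) ∉ O) (S : Finset (Fin (n + 1))) :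
    ∏ i ∈ O, faceF i (some S) = if O ⊆ S then 1 else 0 := by
  split_ifs with hOS
  · refine prod_eq_one fun i hi => ?_
    have hi0 : i ≠ 0 := fun h0 => hO (h0 ▸ hi)
    simp [faceF, hi0, hOS hi]
  · obtain ⟨i, hiO, hiS⟩ := not_subset.1 hOS
    have hi0 : i ≠ 0 := fun h0 => hO (h0 ▸ hiO)
    exact prod_eq_zero hiO (by simp [faceF, hi0, hiS])

/-- **The joint moments of the tail are the block products**: for `0 ∉ O`, `E[Π_{i∈O} faceF i] = W(O)`. [this work] -/
theorem ex_prod_faceF {O : Finset (Fin (n + 1))} (hO : (0 : Fin (n + 1)) ∉ O) :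
    ex (faceμ h p) (fun x => ∏ i ∈ O, faceF i x) = blockW h p O := by
  rw [ex_def, Fintype.sum_option]
  have hnone : faceμ h p none * ∏ i ∈ O, faceF i none = h 0 (p 0) := by simp [faceμ, faceF]
  have hsome : ∑ S : Finset (Fin (n + 1)), faceμ h p (some S) * ∏ i ∈ O, faceF i (some S) =
      blockW h p O - h 0 (p 0) := by
    simp_rw [prod_faceF_some hO, mul_ite, mul_one, mul_zero]
    rw [← sum_filter]
    exact sum_supset_mobius (fun O => blockW h p O - h 0 (p 0)) O
  rw [hnone, hsome]
  ring

/-- A block through the head reads only the head: `E[Π_{i∈O} faceF i] = h_0(p_0)` for `0 ∈ O`. [this work] -/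
theorem ex_prod_faceF_of_mem {O : Finset (Fin (n + 1))} (hO : (0 : Fin (n + 1)) ∈ O) :
    ex (faceμ h p) (fun x => ∏ i ∈ O, faceF i x) = h 0 (p 0) := by
  rw [ex_def, Fintype.sum_option]
  have hzero : ∀ S : Finset (Fin (n + 1)), ∏ i ∈ O, faceF i (some S) = 0 := fun S =>
    prod_eq_zero hO (by simp [faceF])
  simp_rw [hzero, mul_zero, sum_const_zero, add_zero]
  simp [faceμ, faceF]

variable {h p}

/-- An absorbed head swallows every tail block: `h_0(x) · Π_{i∈S} h_i(x) = h_0(x)` for `0 ∉ S`. [this work] -/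
theorem head_mul_prod_eq (habs : ∀ j : Fin n, ∀ x, h 0 x * h j.succ x = h 0 x) {S : Finset (Fin (n + 1))}
    (hS : (0 : Fin (n + 1)) ∉ S) (x : X) : h 0 x * ∏ i ∈ S, h i x = h 0 x := by
  induction S using Finset.induction_on with
  | empty => simp
  | insert a S haS ih =>
    rw [mem_insert, not_or] at hS
    rw [prod_insert haS, ← mul_assoc, mul_comm (h 0 x) (h a x), mul_assoc, ih hS.2]
    obtain ⟨j, rfl⟩ := Fin.exists_succ_eq.2 (Ne.symm hS.1)
    rw [mul_comm]
    exact habs j x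

/-- **The cycle product read at least-element representatives IS `E_σ` under the signed weight**:
`Π_i h_i(p_{rep σ i}) = cycleE (faceμ h p) faceF σ` (absorbed head). [this work] -/
theorem prod_rep_eq_cycleE (habs : ∀ j : Fin n, ∀ x, h 0 x * h j.succ x = h 0 x) (σ : Perm (Fin (n + 1))) :
    ∏ i, h i (p (rep σ i)) = cycleE (faceμ h p) faceF σ := by
  -- regroup the product over `i` along the fibres of `rep σ`
  have hfib : ∏ i, h i (p (rep σ i)) = ∏ j, ∏ i ∈ univ.filter (fun i => rep σ i = j), h i (p j) := by
    rw [← Finset.prod_fiberwise_of_maps_to (g := rep σ) (t := univ) (fun i _ => mem_univ _)]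
    refine prod_congr rfl fun j _ => prod_congr rfl fun i hi => ?_
    rw [mem_filter] at hi
    rw [hi.2]
  rw [hfib, ← Finset.prod_filter_mul_prod_filter_not univ (fun j => rep σ j = j)]
  have hnot : ∏ j ∈ univ.filter (fun j => ¬ rep σ j = j), ∏ i ∈ univ.filter (fun i => rep σ i = j), h i (p j) = 1 := by
    refine prod_eq_one fun j hj => ?_
    rw [mem_filter] at hj
    have hemp : univ.filter (fun i => rep σ i = j) = ∅ := by
      rw [Finset.filter_eq_empty_iff]
      intro i _ h
      exact hj.2 (by rw [← h, rep_rep])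
    rw [hemp, prod_empty]
  rw [hnot, mul_one]
  -- representatives ↔ cycles
  unfold cycleE
  rw [orbits_eq_image_reps, Finset.prod_image (orbit_injOn_reps σ)]
  refine prod_congr rfl fun j hj => ?_
  rw [mem_filter] at hj
  have hfilt : univ.filter (fun i => rep σ i = j) = orbit σ j := by
    ext i
    simp only [mem_filter, mem_univ, true_and, mem_orbit]
    exact rep_eq_iff hj.2 i
  rw [hfilt]
  by_cases h0 : (0 : Fin (n + 1)) ∈ orbit σ j
  · -- the block through the head: `j = 0`, both sides are `h_0(p_0)`
    have hj0 : j = 0 := by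
      have h1 : rep σ 0 = j := (rep_eq_iff hj.2 0).2 (mem_orbit.1 h0)
      have h2 : rep σ 0 ≤ 0 := Finset.min'_le _ _ (self_mem_orbit σ 0)
      rw [← h1]
      exact le_antisymm h2 (Fin.zero_le _)
    subst hj0
    rw [ex_prod_faceF_of_mem h p h0, ← Finset.mul_prod_erase _ _ h0,
      head_mul_prod_eq habs (Finset.notMem_erase 0 _)]
  · -- a tail block: both sides are `W(orbit σ j)`, `min (orbit σ j) = rep σ j = j`
    rw [ex_prod_faceF h p h0, blockW, dif_pos ⟨j, self_mem_orbit σ j⟩]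
    have hmin : (orbit σ j).min' ⟨j, self_mem_orbit σ j⟩ = j := hj.2
    rw [hmin]

/-- **THE REPRESENTATIVE FORM OF AN ABSORBED FAMILY IS `E_{n+1}` UNDER THE SIGNED WEIGHT, HENCE `≥ 0`**:
`Σ_σ (−1)^{C_σ−1} Π_i h_i(p_{rep σ i}) = E_{n+1}^{faceμ}(faceF) ≥ 0` whenever `h_0 ≥ 0`, `h_0 · h_j = h_0` and `0 ≤ h_j ≤ 1`
(`j ≥ 1`), for EVERY point assignment `p`. [this work] -/
theorem repSum_nonneg_of_absorbed (hg0 : ∀ x, 0 ≤ h 0 x) (habs : ∀ j : Fin n, ∀ x, h 0 x * h j.succ x = h 0 x)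
    (h01 : ∀ j : Fin n, ∀ x, 0 ≤ h j.succ x ∧ h j.succ x ≤ 1) :
    0 ≤ ∑ σ : Perm (Fin (n + 1)), (-1 : ℝ) ^ ((orbits σ).card - 1) * ∏ i, h i (p (rep σ i)) := by
  simp_rw [prod_rep_eq_cycleE habs]
  have hcyc : ∑ σ : Perm (Fin (n + 1)), (-1 : ℝ) ^ ((orbits σ).card - 1) * cycleE (faceμ h p) faceF σ =
      sahiE (faceμ h p) (n + 1) faceF := by
    rw [sahiE_eq_sahiECycle _ (n + 1) (by omega)]
    rfl
  rw [hcyc]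
  have hcons : (faceF : Fin (n + 1) → Option (Finset (Fin (n + 1))) → ℝ) =
      Fin.cons (faceF 0) (fun j => faceF j.succ) := by
    funext i
    refine Fin.cases ?_ (fun j => ?_) i
    · rfl
    · simp only [Fin.cons_succ]
  rw [hcons]
  refine SahiAbsorbed.sahiE_cons_nonneg_of_absorbed (faceμ h p) (faceF 0) (fun j => faceF j.succ)
    (fun j x => faceF_zero_mul j.succ x) ?_ ?_
  · rw [ex_faceF_zero]
    exact hg0 _
  · intro B hB
    have hmap : (fun x => ∏ j ∈ B, faceF (n := n) j.succ x) = fun x => ∏ i ∈ B.map (Fin.succEmb n), faceF i x := by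
      funext x
      rw [prod_map]
      rfl
    have h0 : (0 : Fin (n + 1)) ∉ B.map (Fin.succEmb n) := by
      rw [mem_map]
      rintro ⟨j, _, hj⟩
      exact Fin.succ_ne_zero j hj
    rw [hmap, ex_prod_faceF h p h0, blockW, dif_pos ((map_nonempty).2 hB)]
    refine prod_le_one (fun i hi => ?_) (fun i hi => ?_)
    · obtain ⟨j, _, rfl⟩ := mem_map.1 hi
      exact (h01 j _).1
    · obtain ⟨j, _, rfl⟩ := mem_map.1 hi
      exact (h01 j _).2

end Face

/-! ### The slot face theorem -/

section SlotFace

open scoped Classical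

variable {d n : ℕ}

/-- **Every term of the pattern functional of an absorbed family is `≥ 0`**: `diagForm d (n+1) (h ∘ τ) ≥ 0` for every
relabelling `τ`. [this work] -/
theorem diagForm_comp_act_nonneg_of_absorbed (h : Fin (n + 1) → Q d (n + 1) → ℝ) (hg0 : ∀ x, 0 ≤ h 0 x)
    (habs : ∀ j : Fin n, ∀ x, h 0 x * h j.succ x = h 0 x) (h01 : ∀ j : Fin n, ∀ x, 0 ≤ h j.succ x ∧ h j.succ x ≤ 1)
    (τ : Fin d → Perm (Fin (n + 1))) : 0 ≤ diagForm d (n + 1) (fun i => h i ∘ act τ) :=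
  repSum_nonneg_of_absorbed (p := fun k => act τ (diag k)) hg0 habs h01

/-- **THE SLOT FACE THEOREM (every `d`, every order `n+1`)**: `patternForm d (n+1) h ≥ 0` for every family with `h_0 ≥ 0`,
`h_0 · h_j = h_0`, `0 ≤ h_j ≤ 1` — coefficientwise nonnegativity of `E_{n+1}` in the chain weights, on every `d`-grid, for absorbed
families. [this work] -/
theorem patternForm_nonneg_of_absorbed (h : Fin (n + 1) → Q d (n + 1) → ℝ) (hg0 : ∀ x, 0 ≤ h 0 x)
    (habs : ∀ j : Fin n, ∀ x, h 0 x * h j.succ x = h 0 x) (h01 : ∀ j : Fin n, ∀ x, 0 ≤ h j.succ x ∧ h j.succ x ≤ 1) :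
    0 ≤ patternForm d (n + 1) h :=
  sum_nonneg fun τ _ => diagForm_comp_act_nonneg_of_absorbed h hg0 habs h01 τ

/-- **Events: a member inside all the others** — for ARBITRARY finsets `U_0 ⊆ U_j` of the slot cube (no up-set hypothesis),
`patternForm d (n+1) (1_{U_0}, 1_{U_1}, …, 1_{U_n}) ≥ 0`. [this work] -/
theorem patternForm_setInd_nonneg_of_subset (U : Fin (n + 1) → Finset (Q d (n + 1))) (hU : ∀ j : Fin n, U 0 ⊆ U j.succ) :
    0 ≤ patternForm d (n + 1) (fun i => setInd (U i)) := by
  refine patternForm_nonneg_of_absorbed _ (fun x => setInd_nonneg _ _) (fun j x => ?_) (fun j x => ?_)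
  · simp only [setInd_apply]
    by_cases hx : x ∈ U 0
    · rw [if_pos hx, if_pos (hU j hx), mul_one]
    · rw [if_neg hx, zero_mul]
  · simp only [setInd_apply]
    split_ifs <;> norm_num

/-- **The C-slot SIGN⁺ law** (every `d`, every order): for a point `y` lying in every `U_j`,
`patternForm d (n+1) (1_{{y}}, 1_{U_1}, …, 1_{U_n}) ≥ 0` — the slot profile is nonnegative on the intersection. [this work] -/
theorem patternForm_single_nonneg (y : Q d (n + 1)) (U : Fin n → Finset (Q d (n + 1))) (hy : ∀ j, y ∈ U j) :
    0 ≤ patternForm d (n + 1) (Fin.cons (setInd {y}) (fun j => setInd (U j))) := by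
  have hfam : (Fin.cons (setInd {y}) (fun j => setInd (U j)) : Fin (n + 1) → Q d (n + 1) → ℝ) =
      fun i => setInd ((Fin.cons ({y} : Finset (Q d (n + 1))) U : Fin (n + 1) → Finset (Q d (n + 1))) i) := by
    funext i
    refine Fin.cases ?_ (fun j => ?_) i
    · rfl
    · simp only [Fin.cons_succ]
  rw [hfam]
  refine patternForm_setInd_nonneg_of_subset _ fun j => ?_
  simp only [Fin.cons_zero, Fin.cons_succ, singleton_subset_iff]
  exact hy j

end SlotFace

end SahiSlot

end Summit.CriticalPhenomena.PercolationContinuityZ3.Theorems
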